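import Summits.QuantumFields.QCD.Theorems.QuarksAsStableActionStableActionBridgeStubCyclicScalarise

/-!
# Stub `stub_cyclic_scalarise_slices` of line `twisted_trace_transfer`
(crux `QuarksAsStableAction.StableActionBridge`, item stmt-QuantumFields-9737; sub-goal B5′ of step E3)

The all-extent form of the landed sub-goal B5 (`stub_cyclic_scalarise`): for `m + 2` time slices
(indexed by `Fin (m + 2)`) on the spatial three-torus of side `S`, the thermal trace
`∫∫ ∏_t K_β(U_t, U_{t+1}^{g_t}) · Tr ∏_t T̂_F(U_t) Γ(G_{g_t}) dU dg` and its twisted companion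
(supertrace `Σ_s (−1)^{#s} (·)_{ss}` in place of the trace) are cyclic integrals
`∫ ∏_{t : Fin (m+2)} k(V t, V (t+1)) d(Haar ⊗ count)^{⊗(m+2)}(V)` of the scalarised kernel
`k((U,s),(U',s')) = (R(U) B(U,U') R(U'))_{s s'}` on `Y = SU(3)^{E₃} × Finset(modes)`, with the
Gauss-averaged bond kernel `B(U,U')_{a c} = ∫ K_β(U, U'^g) Γ(G_g)_{a c} dg`, for any continuous pointwise
square root `R(U)² = T̂_F(U)` commuting with the fermion parity (the twisted trace acquires the
insertion `(−1)^{#(V 0).2}`).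

Proof.  The abstract core `StubCyclicScalarise.main_fin` of the sibling file is already stated over
`Fin (n + 1)` with `List.ofFn` words and a general diagonal weight `w`; we rewrite `T̂_F = R R` inside the
word, take `n := m + 1` (`Fin (m + 1 + 1) = Fin (m + 2)` definitionally), slices
`X = SU(3)^{Edge 3 S}` with `μ = sliceHaar S`, temporal links `Gt = SU(3)^{TorusSite 3 S}` with the product
Haar probability, `K = K_β`, `act = gaugeTransform`, `Γ = fockGaugeAct`, and the weights `w = 1` (trace,
`Tr M = Σ_s 1 · M_{ss}`) and `w = (−1)^{#s}` (supertrace).  Continuity inputs: the landed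
`Sketch.continuous_gaugeSliceKernel`, `continuous_gaugeTransform_prod`,
`StubCyclicScalarise.continuous_fockGaugeAct`.  Pure theorem file, no helpers.

References: M. Lüscher, Commun. Math. Phys. 54 (1977) 283 [Luscher1977, pp. 283–292]; I. Montvay, G. Münster,
*Quantum Fields on a Lattice* (CUP 1994) [MontvayMunster1994, §4.1.3 (4.34)].
-/

noncomputable section

namespace Summit.QuantumFields.QCD.Cruxes.StableActionBridge.TwistedTraceTransfer

open MeasureTheory
open scoped InnerProductSpace ComplexConjugate Matrix BigOperators
open Literature.MathematicalPhysics.QuantumFieldTheory Literature.MathematicalPhysics.QuantumLattice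
open Literature.Probability.LatticeModels (TorusSite)

/-- **Sub-goal B5′ of E3 (registered stub `stub_cyclic_scalarise_slices` of line `twisted_trace_transfer`):
the `(m+2)`-slice thermal / twisted traces on spatial side `S` are cyclic integrals over
`Y = SU(3)^{E₃} × Finset(modes)` of the scalarised kernel.**  For any continuous pointwise square root
`R(U)² = T̂_F(U)` commuting with the fermion parity `Π = diag((−1)^{#s})`, with the Gauss-averaged bond
kernel `B(U,U')_{a c} = ∫ K_β(U, U'^g) Γ(G_g)_{a c} dg` and `k((U,s),(U',s')) = (R(U) B(U,U') R(U'))_{s s'}`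
(measure `Haar ⊗ count`):
`∫∫ ∏_t K_β(U_t, U_{t+1}^{g_t}) · Tr ∏_t T̂_F(U_t) Γ(G_{g_t}) dU dg = ∫ ∏_{t : Fin (m+2)} k(V t, V (t+1)) d(Haar ⊗ count)^{⊗(m+2)}(V)`,
and the same with the supertrace on the left and the insertion `(−1)^{#(V 0).2}` on the right
(the all-extent form of `stub_cyclic_scalarise`: `T̂_F = R R` and `StubCyclicScalarise.main_fin` at
`n := m + 1`, `w = 1`, `w = (−1)^{#s}`). [cite: Luscher1977, pp. 283–292] [cite: MontvayMunster1994, §4.1.3 (4.34)] -/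
theorem stub_cyclic_scalarise_slices : ∀ (Nf S : ℕ) [NeZero S] (β : ℝ) (mq : Fin Nf → ℝ) (m : ℕ)
    (R : GaugeConfig 3 S (Matrix.specialUnitaryGroup (Fin 3) ℂ) → Matrix (Finset (SliceFermiIdx Nf S)) (Finset (SliceFermiIdx Nf S)) ℂ),
    Continuous R → (∀ U, R U * R U = fermionSliceOp U mq) →
    (∀ U, Matrix.diagonal (fun s : Finset (SliceFermiIdx Nf S) => (-1 : ℂ) ^ s.card) * R U =
      R U * Matrix.diagonal (fun s : Finset (SliceFermiIdx Nf S) => (-1 : ℂ) ^ s.card)) →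
    ((∫ p : (Fin (m + 2) → GaugeConfig 3 S (Matrix.specialUnitaryGroup (Fin 3) ℂ)) × (Fin (m + 2) → TorusSite 3 S → (Matrix.specialUnitaryGroup (Fin 3) ℂ)),
        ((∏ t : Fin (m + 2), gaugeSliceKernel β (p.1 t) (gaugeTransform (p.2 t) (p.1 (t + 1))) : ℝ) : ℂ) *
          ((List.ofFn fun t : Fin (m + 2) => fermionSliceOp (p.1 t) mq * @fockGaugeAct Nf S _ (p.2 t)).prod).trace
        ∂((Measure.pi fun _ : Fin (m + 2) => sliceHaar S).prod
            (Measure.pi fun _ : Fin (m + 2) => Measure.pi fun _ : TorusSite 3 S => haarProbability (Matrix.specialUnitaryGroup (Fin 3) ℂ)))) =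
      ∫ V : Fin (m + 2) → GaugeConfig 3 S (Matrix.specialUnitaryGroup (Fin 3) ℂ) × Finset (SliceFermiIdx Nf S),
        ∏ t : Fin (m + 2), (R (V t).1 * (Matrix.of fun a c => ∫ g : TorusSite 3 S → (Matrix.specialUnitaryGroup (Fin 3) ℂ),
            (gaugeSliceKernel β (V t).1 (gaugeTransform g (V (t + 1)).1) : ℂ) * @fockGaugeAct Nf S _ g a c
              ∂(Measure.pi fun _ => haarProbability (Matrix.specialUnitaryGroup (Fin 3) ℂ))) * R (V (t + 1)).1) (V t).2 (V (t + 1)).2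
        ∂(Measure.pi fun _ => (sliceHaar S).prod Measure.count)) ∧
    ((∫ p : (Fin (m + 2) → GaugeConfig 3 S (Matrix.specialUnitaryGroup (Fin 3) ℂ)) × (Fin (m + 2) → TorusSite 3 S → (Matrix.specialUnitaryGroup (Fin 3) ℂ)),
        ((∏ t : Fin (m + 2), gaugeSliceKernel β (p.1 t) (gaugeTransform (p.2 t) (p.1 (t + 1))) : ℝ) : ℂ) *
          ∑ s : Finset (SliceFermiIdx Nf S), (-1 : ℂ) ^ s.card *
            ((List.ofFn fun t : Fin (m + 2) => fermionSliceOp (p.1 t) mq * @fockGaugeAct Nf S _ (p.2 t)).prod) s s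
        ∂((Measure.pi fun _ : Fin (m + 2) => sliceHaar S).prod
            (Measure.pi fun _ : Fin (m + 2) => Measure.pi fun _ : TorusSite 3 S => haarProbability (Matrix.specialUnitaryGroup (Fin 3) ℂ)))) =
      ∫ V : Fin (m + 2) → GaugeConfig 3 S (Matrix.specialUnitaryGroup (Fin 3) ℂ) × Finset (SliceFermiIdx Nf S),
        (-1 : ℂ) ^ (V 0).2.card *
        ∏ t : Fin (m + 2), (R (V t).1 * (Matrix.of fun a c => ∫ g : TorusSite 3 S → (Matrix.specialUnitaryGroup (Fin 3) ℂ),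
            (gaugeSliceKernel β (V t).1 (gaugeTransform g (V (t + 1)).1) : ℂ) * @fockGaugeAct Nf S _ g a c
              ∂(Measure.pi fun _ => haarProbability (Matrix.specialUnitaryGroup (Fin 3) ℂ))) * R (V (t + 1)).1) (V t).2 (V (t + 1)).2
        ∂(Measure.pi fun _ => (sliceHaar S).prod Measure.count)) := by
  intro Nf S _ β mq m R hRc hR2 hP
  simp only [← hR2]
  haveI : IsProbabilityMeasure (sliceHaar S) := by unfold sliceHaar; infer_instance
  -- the abstract core of the sibling file at `n := m + 1` (`Fin (m + 1 + 1) = Fin (m + 2)` by `rfl`)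
  have key := fun (w : Finset (SliceFermiIdx Nf S) → ℂ)
      (hw : ∀ U, Matrix.diagonal w * R U = R U * Matrix.diagonal w) =>
    StubCyclicScalarise.main_fin (gaugeSliceKernel β) gaugeTransform (fockGaugeAct (Nf := Nf)) R w
      (Measure.pi fun _ : TorusSite 3 S => haarProbability (Matrix.specialUnitaryGroup (Fin 3) ℂ))
      (sliceHaar S) (m + 1) (Sketch.continuous_gaugeSliceKernel S β) continuous_gaugeTransform_prod
      StubCyclicScalarise.continuous_fockGaugeAct hRc hw
  refine ⟨?_, key (fun s => (-1 : ℂ) ^ s.card) hP⟩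
  -- the trace is the weighted diagonal sum with `w = 1`
  have h := key (fun _ => 1) (fun U => by rw [Matrix.diagonal_one, Matrix.one_mul, Matrix.mul_one])
  simp only [one_mul] at h
  exact h

end Summit.QuantumFields.QCD.Cruxes.StableActionBridge.TwistedTraceTransfer

end
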